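import Literature.NumberTheory.LFunctions.Zhang2022.DHMenuConsistentRow13
import Literature.NumberTheory.LFunctions.Zhang2022.DHMenuConsistentRowS2

/-!
# Zhang (2022), rung F-S3, family B-dh — THE §E THEOREM FOR THE B-dh KILL WORD: `MenuConsistent` holds
# (E-057 discharged: the (A)-world `W(D, χ)` of `DHChainBarrier` satisfies every typed menu row, for every `log D ≥ 43 250`)

Y. Zhang, *Discrete mean estimates and the Landau–Siegel zero*, arXiv:2211.02515v1 [Zhang2022LandauSiegel] — an unrefereed
manuscript under adjudication. **The programme SEARCHES and TYPES; no claim about Landau–Siegel zeros, Theorems 1–2 of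
arXiv:2211.02515 or a repaired Margin232 until a kernel theorem says so.** This file proves a statement about the cell's
explicit CONSISTENCY WORLD `DH.world D χ` (abstract zero/value data), namely `Zhang2022.DH.MenuConsistent`
(`DHChainBarrier`, p461081/p461386): it says that the typed numeric instances of the rows of the finite menu `M_typed`,
taken together with Assumption (A) at the datum `(D, χ)`, are simultaneously satisfiable — so no chain of valid deductions
from those typed instances derives `¬(A)_D`. It is NOT a statement about Dirichlet `L`-functions and proves nothing about
them. Cell `landau-siegel`, sub-cell E, stub S-E-p4-5 (ASSEMBLER; ls-barrier-plan 19:14:21Z), bundle entry E-18 of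
HOME/barrier/REF-E.md §0b-v8.

## Assembly (one line)

`menuConsistent_holds := menuConsistent_of_row13 (fun D χ _ hL => world_row13 hL)`, where
* `menuConsistent_of_row13` (ls-barrier-p5, `DHMenuConsistentRowS2`, p467641) = `menuConsistent_of_fenceRows` (ls-Bdh-typer-1,
  `DHMenuConsistentP4B`, p466210: the `Menu` constructor from the sixteen field theorems `world_assumptionA` (typer-2,
  `DHChainBarrier`), `world_row01/02/03/08/09/10/11/12/15/19/S3` (`DHMenuConsistentP4`, p464702), `world_row05/06/S1/S4`
  (`DHMenuConsistentP4B`, p465741)) with `world_row04` (ls-barrier-p1 `row04_of_counts` p465736 + typer-1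
  `DHMenuConsistentRow04High/Low` p466868/p467456) and `world_rowS2` (p5, p467641) already supplied;
* `world_row13` (this seat, `DHMenuConsistentRow13`, p468284; on `DHMenuConsistentWorld` p465409, `DHMenuConsistentFence`
  p466102, `DHMenuConsistentStripCount` p467025).
Rows VACUOUS on the world (honest, counted as such): row01, row02, row06, row19 — no zero of `W` lies off the critical line
inside any window except `β₁` itself (`re_gt_half_zero`), and row19's GLOBAL GRH hypothesis fails on `W` (`β₁` is real).
Non-vacuity of the world: `fenceSet_nonempty` / `fenceOrdinate_pos` (the fence is there), `isZero_pair_self` (the pair is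
there), `betaExc_window` (the exceptional zero sits in the BGTZ window).

SCOPE: the theorem covers `M_typed` ONLY (the fields of `ZeroWorld.Menu`). `M_primes` (dhE-22 + S5/S6) is the companion
`MenuConsistentPrimes` (`DHChainBarrierPrimes`, p464158), bundle entry E-18b, theorem-in-waiting `menuConsistentPrimes_holds`
(ls-Bdh-typer-2) — NOT proved here. `M_informal` (dhE-07, dhE-14, dhE-18(ii), dhE-28, BGTZ Cor 1.2, Kadiri ∃R₀) is NEVER
covered by a kernel statement: a design instantiating an `M_informal` row as load-bearing re-opens the certificate at that
row. B-AH / the model-expectation identity is not used anywhere (B-dh has no moment / main-order block; the ls-lead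
18:15:52Z rule «B-AH may be cited only for main-order positivity of a limit of PSD forms» is met vacuously). No number is
load-bearing: every numeric row is a kernel inequality on exact rationals with Mathlib's `Real.exp` / `Real.log` / `Real.pi`
bounds (`norm_num`, no `native_decide`).
-/

noncomputable section

open scoped Classical

namespace Literature.NumberTheory.LFunctions.Zhang2022.DH

/-- **E-057 DISCHARGED: `MenuConsistent` holds** — for every modulus `D` with `log D ≥ 43 250` and every primitive
quadratic `χ ≠ χ₀` mod `D`, the (A)-world `W(D, χ)` satisfies the whole typed menu: `(world D χ).Menu D χ`. This is the §E
proof obligation of the B-dh KILL word of record (director-frontier g6 2026-08-26T19:31:07Z); the word's sentence,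
B-dh/KILL-draft.md v1.4.5 (3fef880895ed21b9) §1, VERBATIM (one typographic change: a blank inserted in «dh-cnf-001/ -002» to
keep this comment well-formed):

«KILL(B-dh) inside Σ_menu GIVEN E-057 (`Zhang2022.DH.MenuConsistent`, typed rc 0 p461081/p461386; its PROOF is the §E
theorem — the P4/(A)/binder/P6 conjuncts are already kernel theorems `Zhang2022.DHMenuLines` p459347, the fence/count
conjuncts carry two-lineage certified margins; premise named BY ID as the B-multi word names B-AH/E-014, and
DISCHARGED — not merely assumed — when §E lands the proof): no design d whose inputs are instances of the finite MENU
M := M_typed (the fields of E-057 `MenuConsistent`: rows (A), dhE-01–06, 08–13, 15, 19 and S1–S4) ∪ M_primes (dhE-22 =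
E-055 + S5/S6: companion `Zhang2022.DH.MenuConsistentPrimes` p464158 ACCEPTED 853ee79ff3a1 — the word EXTENDS to it on
REF-B3's countersignature of the companion, director term (i)) ∪ M_informal (dhE-07, dhE-14, dhE-18(ii), dhE-28, BGTZ
Cor 1.2, Kadiri ∃R₀ — met by W⁺ by inspection, NOT covered by the kernel statement), as enumerated below and in §2
(parameters anywhere in their typed/printed ranges, any moduli q : ℕ, any Q, T in range, in any finite combination,
followed by valid deductions); THE KERNEL STATEMENT COVERS M_typed (and M_primes by its companion) — REF-B3 W1
19:24:30Z — closes: for every 𝓛 ≥ 𝓛₀ := 43 250 the explicit world W⁺(𝓛) of §3 satisfies (A)_D (D = ⌊e^𝓛⌋-scale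
modulus, q : ℕ throughout — A8) together with every instance of every row of M — kernel certificate
`Zhang2022.DH.MenuConsistent` (dhE-24 = E-057, typed rc 0 by ls-Bdh-typer-2, proof = §E target) — hence the
certificate REFUTES DERIVATIONS of ¬(A)_D FROM THE TYPED NUMERIC INSTANCES OF THE ROWS of M (any finite combination,
followed by valid deductions), for every 𝓛 ≥ 𝓛₀ (ls-ref-1 census wording 18:57:02Z). NO NUMBER IS LOAD-BEARING for the
word: the P4/(A)/binder/P6 lines are kernel theorems for all L ≥ 43250 (`Zhang2022.DHMenuLines`, p459347) and the
fence/count rows are met with integer-sized slack; every decimal quoted in this certificate is a truncation of a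
two-lineage certified enclosure (A j257256/j256836/j257060 × B j257070/j257215/j257558) or a labelled single-lineage
illustration (A j257313 consistency roots), none enters the KILL sentence as a premise. SCOPE (A9, adjacent by
design): 𝓛 < 𝓛₀ is a finite range of moduli and cannot close the family because the exit theorem
`Skeleton.theorem1_of_eventually_not_assumptionA` needs ¬(A)_D for all D ≥ D₀ (the finite-range closures are real and
recorded: dh-cnf-001/ -002, 𝓛*₀.₆₉ = 43159.4847… (A j257060) ∈ (43159.482, 43159.487) (B j257558), two-lineage).
OUTSIDE M BY ID (A7): dhE-16 (Oesterlé print floor — numerically inside dhE-15's bracket, covered by dh-cnf-002 as a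
design, not instantiated in the certificate), dhE-17 (Skeleton Part-1 fence rows — P5 DROPPED, A2: no faithful
ZeroWorld dictionary; covered by design dh-struct-001 only), dhE-18(i) and dhE-20 (distribution / moment / S(t) rows —
A1: context, not instantiated; a design instantiating one re-opens the certificate), dhE-21 (= E-054; UniformABC ⇒ no
Siegel zero: conditional XL, verdict word «no (XL, conditional)»), dhE-23 (tail schema), dhE-25/dhE-26/dhE-27
(Conrey–Iwaniec 2002 Thm 1.2 `conreyIwaniec2002_theorem12` + the OPEN subnormal-ζ-gaps hypothesis
`SubnormalGapsHypothesis` (⇐ RH + `MontgomeryPairCorrelation` + Gabcke, PROVED in tree) — exit kind (viii), design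
dh-ci-001: closes ODD χ only, conditionally), dhE-28 (`motohashi1977_theoremII`, P2-shape ∃C row: met by W⁺ trivially
(off-line count 0 for α > ¾) — inside the CLASS Σ_menu as a P2 instance but not a named conjunct of E-057 v2), dhE-29
(Ramaré 2016 Math. Comp. 85 Thm 1.1 explicit Ingham-type density, untyped context: additive term ≥ 1 ⇒ cannot exclude
a zero; met by W⁺; class-member P2). The inputs that EXIT the certificate are exactly the kinds (i)–(viii) of §4, each
of E*-len/E*-ℓ strength, a GRH-counterexample, a distribution-row instantiation, or (viii) a fine-structure statement
about ζ's critical-line zeros (subnormal gaps / pair correlation) that an Alternative-Hypothesis-type fence fails; the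
class handed to §E as barrier-extension target is Σ_menu(P1–P4, P6, P7, S1–S6) := {chains over M}.»

COVERAGE OF THIS THEOREM: `M_typed` ONLY (the fields of `ZeroWorld.Menu`: (A), dhE-01–06, 08–13, 15, 19, S1–S4); `M_primes`
by the companion `MenuConsistentPrimes` / `menuConsistentPrimes_holds` (E-18b, not here); `M_informal` NEVER — a design
instantiating an `M_informal` row re-opens the certificate at that row. B-AH is not used (B-dh has no main-order block; the
ls-lead 18:15:52Z rule is met vacuously). Vacuous-on-W⁺ rows: 01, 02, 06, 19. The programme SEARCHES and TYPES; no claim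
about Landau–Siegel zeros, Theorems 1–2 of arXiv:2211.02515 or a repaired Margin232 until a kernel theorem says so.
[cite: Zhang2022LandauSiegel, §2 Assumption (A)] -/
theorem menuConsistent_holds : MenuConsistent :=
  menuConsistent_of_row13 fun _ _ _ hL => world_row13 hL

/-- The referee's C2 probe (REF-E §0b-v8): the proved type is the accepted definition BY NAME. [cite: Zhang2022LandauSiegel, §2 Assumption (A)] -/
example : Literature.NumberTheory.LFunctions.Zhang2022.DH.MenuConsistent := menuConsistent_holds

end Literature.NumberTheory.LFunctions.Zhang2022.DH
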